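import Literature.Analysis.FluidPDE.KochTataru
import Literature.Analysis.FunctionSpaces.Complexify
import Literature.Analysis.Complex.HolomorphicParametricIntegral
import Mathlib.Analysis.InnerProductSpace.Calculus
import Mathlib.Analysis.SpecialFunctions.ImproperIntegrals
import Mathlib.MeasureTheory.Integral.IntegralEqImproper
import HarnessLib

/-!
# The complexified Gauss–Weierstrass and Oseen–Koch–Tataru kernels (root-time variables)

Analysis/FluidPDE definitions file, first layer (W1) of the proof of the named fact
`Literature.Analysis.FluidPDE.lemarieRieusset2016_local_analyticity` (`NSBoundedMildAnalytic.lean`;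
Lemarié-Rieusset 2016, Thm. 9.12: the bounded mild solution from a bounded datum is real-analytic
in `(t, x)` on its window of existence — proof after Cannon–Knightly by holomorphic extension of
Oseen's scheme). The plan recorded there complexifies **time** and a **Galilean parameter** (not
the space variable), which needs the kernels of Oseen's scheme — the Gauss–Weierstrass kernel
`G_t(z) = (4πt)^{-d/2} e^{-|z|²/4t}` (`UnboundedOperators.heatKernel`) and Koch–Tataru's kernel
`K(t, z)[a, b]` of `e^{tΔ}ℙ∇·` on rank-one tensors (`oseenKernel`, `KochTataru.lean`, closed
Gaussian form with the weights `A(t,z) = ∫_t^∞ G_s(z)/(4s²) ds`, `B(t,z) = ∫_t^∞ G_s(z)/(8s³) ds`) —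
at complex times and complex displacements. This file defines these extensions and proves that
they are holomorphic and restrict to the real kernels.

**Root-time variables.** All kernels are written in the variable `m` with `m² = t` ("root
time"), so that no complex power or square root ever occurs: `t^{-d/2} = m^{-d}`,
`(4πt)^{-d/2} = (4π)^{-d/2} m^{-d}`, and the weights become, after the *linear* substitution
`s = tσ` in their defining integrals,
`A(t, z) = (4πt)^{-d/2} (4t)^{-1} Ψ_{d/2+2}(|z|²/4t)`, `B(t, z) = (4πt)^{-d/2} (8t²)^{-1} Ψ_{d/2+3}(|z|²/4t)`
with the entire functions `Ψ_q(w) = ∫_1^∞ σ^{-q} e^{-w/σ} dσ` (`psiWeight q`). Complex vectors are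
`EuclideanSpace ℂ ι`, real vectors embed by `EuclideanSpace.complexify` (`Complexify.lean`), and
the Euclidean inner product is continued **bilinearly** (`cdot ζ a = ∑ᵢ ζᵢ aᵢ`, not sesquilinearly),
as holomorphy demands.

* `cdot`, `cdot_complexify`, `norm_cdot_le` (Cauchy–Schwarz `‖ζ·a‖ ≤ ‖ζ‖‖a‖`);
* `psiWeight q w = ∫_{σ>1} σ^{-q} e^{-w/σ} dσ`: entire in `w` for `q > 1`
  (`differentiable_psiWeight`, by holomorphy of dominated parameter integrals,
  `Complex.differentiableOn_integral_of_dominated`), real on reals (`psiWeight_ofReal`);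
* `heatKernelC m ζ = (4π)^{-d/2} m^{-d} exp(-ζ·ζ/4m²)`, `oseenWeightAC`, `oseenWeightBC`,
  `oseenKernelC m ζ a b` — the closed form of `oseenKernel` with every ingredient continued;
* holomorphy in all arguments jointly, in composable form (`DifferentiableAt.heatKernelC`,
  `.oseenWeightAC`, `.oseenWeightBC`, `.oseenKernelC`: at points where `m ≠ 0`);
* **real restriction**: for `t > 0` and real `z, a, b`,
  `heatKernelC √t (cx z) = G_t(z)`, `oseenWeightAC √t (cx z) = A(t, z)`,
  `oseenWeightBC √t (cx z) = B(t, z)` (the substitution `s = tσ`,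
  `MeasureTheory.integral_comp_mul_left_Ioi`), and
  `oseenKernelC √t (cx z) (cx a) (cx b) = cx (K(t, z)[a, b])`.

Bounds on parabolic sectors (`|Im m| ≤ κ Re m`, displacements `Im` of size `≤ |m|`) are the next
layer (W2). Nothing here is specific to dimension three.

## Mathlib / tree search

Tree: `oseenKernel`, `oseenWeightA`, `oseenWeightB` (`KochTataru.lean`), `UnboundedOperators.heatKernel`
(`HeatKernel.lean`), `EuclideanSpace.complexify` (`Complexify.lean`),
`Complex.differentiableOn_integral_of_dominated` (`HolomorphicParametricIntegral.lean`).
Mathlib: `dotProduct` is the bilinear pairing on `ι → R` but `EuclideanSpace` is `PiLp 2`, so a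
two-line `cdot` is defined here rather than transported; `Finset.sum_mul_sq_le_sq_mul_sq`
(discrete Cauchy–Schwarz), `EuclideanSpace.norm_eq`, `integral_comp_mul_left_Ioi`,
`integrableOn_Ioi_rpow_of_lt`, `integral_ofReal`, `Complex.norm_exp`, `Real.sqrt_eq_rpow`,
`Real.mul_rpow`, `Real.rpow_natCast`, `Real.rpow_mul`.

## References

* P. G. Lemarié-Rieusset, *The Navier–Stokes Problem in the 21st Century*, CRC Press 2016,
  Thm. 9.12 and its proof, pp. 260–263 (holomorphic extension of `W_{νt}` and of the Oseen tensor,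
  (9.39)–(9.43)). [LemarieRieusset2016]
* H. Koch, D. Tataru, Adv. Math. 157 (2001), §2 (6)–(8) (the kernel of `Π∇S(t)`; the tree's
  `oseenKernel`). [KochTataruAdvMath2001]
-/

noncomputable section

open MeasureTheory Set Filter Metric Real
open _root_.Topology
open scoped BigOperators

namespace Literature.Analysis.FluidPDE

open Literature.Analysis.FunctionSpaces (EuclideanSpace.complexify)
open Literature.Analysis.FunctionSpaces.EuclideanSpace (complexify complexify_apply)

variable {ι : Type*} [Fintype ι]

/-- Local notation: complex coordinate space `ℂ^ι`. -/
local notation "ℂE" => EuclideanSpace ℂ ι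
/-- Local notation: real coordinate space `ℝ^ι`. -/
local notation "ℝE" => EuclideanSpace ℝ ι

/-! ### The bilinear continuation of the inner product -/

/-- **The bilinear pairing on `ℂ^ι`**, `cdot ζ a = ∑ᵢ ζᵢ aᵢ` — the holomorphic (bilinear, *not*
sesquilinear) continuation of the Euclidean inner product of `ℝ^ι`, through which `|z|²`,
`⟪z, a⟫` enter the complexified kernels (Lemarié-Rieusset 2016, proof of Thm. 9.12, p. 262:
`Z² = z₁² + z₂² + z₃²`). [folklore] -/
def cdot (ζ a : ℂE) : ℂ := ∑ i, ζ i * a i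

omit [Fintype ι] in
/-- Unfolding `cdot`. [folklore] -/
theorem cdot_def [Fintype ι] (ζ a : ℂE) : cdot ζ a = ∑ i, ζ i * a i := rfl

/-- `cdot` is symmetric. [folklore] -/
theorem cdot_comm (ζ a : ℂE) : cdot ζ a = cdot a ζ := by
  simp only [cdot, mul_comm]

/-- `cdot` is additive on the left. [folklore] -/
theorem cdot_add_left (ζ ξ a : ℂE) : cdot (ζ + ξ) a = cdot ζ a + cdot ξ a := by
  simp only [cdot, PiLp.add_apply, add_mul, Finset.sum_add_distrib]

/-- `cdot` is additive on the right. [folklore] -/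
theorem cdot_add_right (ζ a b : ℂE) : cdot ζ (a + b) = cdot ζ a + cdot ζ b := by
  simp only [cdot, PiLp.add_apply, mul_add, Finset.sum_add_distrib]

/-- `cdot` is homogeneous on the left. [folklore] -/
theorem cdot_smul_left (c : ℂ) (ζ a : ℂE) : cdot (c • ζ) a = c * cdot ζ a := by
  simp only [cdot, PiLp.smul_apply, smul_eq_mul, Finset.mul_sum, mul_assoc]

/-- `cdot` is homogeneous on the right. [folklore] -/
theorem cdot_smul_right (c : ℂ) (ζ a : ℂE) : cdot ζ (c • a) = c * cdot ζ a := by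
  rw [cdot_comm, cdot_smul_left, cdot_comm]

/-- `cdot` vanishes against `0` on the right. [folklore] -/
@[simp]
theorem cdot_zero_right (ζ : ℂE) : cdot ζ 0 = 0 := by
  simp [cdot]

/-- `cdot` vanishes against `0` on the left. [folklore] -/
@[simp]
theorem cdot_zero_left (a : ℂE) : cdot 0 a = 0 := by
  simp [cdot]

/-- `cdot` is odd in the left argument. [folklore] -/
theorem cdot_neg_left (ζ a : ℂE) : cdot (-ζ) a = -cdot ζ a := by
  simp only [cdot, PiLp.neg_apply, neg_mul, Finset.sum_neg_distrib]

/-- `cdot (ζ - ξ) a = cdot ζ a - cdot ξ a`. [folklore] -/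
theorem cdot_sub_left (ζ ξ a : ℂE) : cdot (ζ - ξ) a = cdot ζ a - cdot ξ a := by
  rw [sub_eq_add_neg, cdot_add_left, cdot_neg_left, ← sub_eq_add_neg]

/-- **On real vectors `cdot` is the real inner product**: `cdot (cx z) (cx a) = ⟪z, a⟫_ℝ`.
[folklore] -/
theorem cdot_complexify (z a : ℝE) :
    cdot (complexify z) (complexify a) = ((inner ℝ z a : ℝ) : ℂ) := by
  simp [cdot, PiLp.inner_apply, mul_comm, Complex.ofReal_sum]

/-- `cdot (cx z) (cx z) = ‖z‖²`. [folklore] -/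
theorem cdot_complexify_self (z : ℝE) :
    cdot (complexify z) (complexify z) = ((‖z‖ ^ 2 : ℝ) : ℂ) := by
  rw [cdot_complexify, real_inner_self_eq_norm_sq]

/-- **Cauchy–Schwarz for the bilinear pairing**: `‖cdot ζ a‖ ≤ ‖ζ‖ ‖a‖` (triangle inequality and
the discrete Cauchy–Schwarz inequality for the moduli). [folklore] -/
theorem norm_cdot_le (ζ a : ℂE) : ‖cdot ζ a‖ ≤ ‖ζ‖ * ‖a‖ := by
  have h1 : ‖cdot ζ a‖ ≤ ∑ i, ‖ζ i‖ * ‖a i‖ := by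
    unfold cdot
    refine (norm_sum_le _ _).trans (Finset.sum_le_sum fun i _ => ?_)
    rw [norm_mul]
  have h2 : (∑ i, ‖ζ i‖ * ‖a i‖) ^ 2 ≤ ‖ζ‖ ^ 2 * ‖a‖ ^ 2 := by
    rw [EuclideanSpace.norm_sq_eq ζ, EuclideanSpace.norm_sq_eq a]
    exact Finset.sum_mul_sq_le_sq_mul_sq _ _ _
  have h3 : ∑ i, ‖ζ i‖ * ‖a i‖ ≤ ‖ζ‖ * ‖a‖ := by
    rw [← mul_pow] at h2
    exact (pow_le_pow_iff_left₀ (Finset.sum_nonneg fun i _ => by positivity) (by positivity)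
      two_ne_zero).1 h2
  exact h1.trans h3

/-- `cdot ζ ζ` has norm at most `‖ζ‖²`. [folklore] -/
theorem norm_cdot_self_le (ζ : ℂE) : ‖cdot ζ ζ‖ ≤ ‖ζ‖ ^ 2 := by
  rw [sq]; exact norm_cdot_le ζ ζ

/-- **Holomorphy of `cdot`** (a polynomial): if `f`, `g` are complex differentiable at `p` then so
is `p ↦ cdot (f p) (g p)`. [folklore] -/
theorem _root_.DifferentiableAt.cdot {P : Type*} [NormedAddCommGroup P] [NormedSpace ℂ P]
    {f g : P → ℂE} {p : P} (hf : DifferentiableAt ℂ f p) (hg : DifferentiableAt ℂ g p) :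
    DifferentiableAt ℂ (fun q => cdot (f q) (g q)) p := by
  unfold Literature.Analysis.FluidPDE.cdot
  refine DifferentiableAt.fun_sum fun i _ => ?_
  exact ((differentiableAt_euclidean.1 hf) i).mul ((differentiableAt_euclidean.1 hg) i)

/-- Continuity of `cdot` in both arguments. [folklore] -/
theorem continuous_cdot : Continuous fun p : ℂE × ℂE => cdot p.1 p.2 := by
  unfold cdot
  refine continuous_finsetSum _ fun i _ => ?_
  exact ((EuclideanSpace.proj i).continuous.comp continuous_fst).mul
    ((EuclideanSpace.proj i).continuous.comp continuous_snd)

/-! ### The weight functions `Ψ_q(w) = ∫_1^∞ σ^{-q} e^{-w/σ} dσ` -/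

/-- **The weight function** `Ψ_q(w) = ∫_{σ>1} σ^{-q} e^{-w/σ} dσ` (`q > 1`, `w ∈ ℂ`): the entire
function through which the Oseen weights `A = ∫_t^∞ G_s/(4s²) ds`, `B = ∫_t^∞ G_s/(8s³) ds`
factor after the substitution `s = tσ` — `A(t,z) = (4πt)^{-d/2}(4t)^{-1} Ψ_{d/2+2}(|z|²/4t)`,
`B(t,z) = (4πt)^{-d/2}(8t²)^{-1} Ψ_{d/2+3}(|z|²/4t)` (`oseenWeightA_eq`, `oseenWeightB_eq`). The
exponent `σ^{-q}` is the real power of the real variable `σ > 1`. [folklore] -/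
def psiWeight (q : ℝ) (w : ℂ) : ℂ :=
  ∫ σ in Ioi (1 : ℝ), ((σ ^ (-q) : ℝ) : ℂ) * Complex.exp (-(w / σ))

/-- The integrand of `Ψ_q` is measurable in `σ`. [folklore] -/
theorem measurable_psiWeight_integrand (q : ℝ) (w : ℂ) :
    Measurable fun σ : ℝ => ((σ ^ (-q) : ℝ) : ℂ) * Complex.exp (-(w / σ)) := by
  refine (Complex.measurable_ofReal.comp (measurable_id.pow_const _)).mul ?_
  exact Complex.measurable_exp.comp ((measurable_const.div Complex.measurable_ofReal).neg)

/-- The modulus of the integrand of `Ψ_q`: `|σ^{-q} e^{-w/σ}| = σ^{-q} e^{-Re w/σ}` for `σ > 0`.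
[folklore] -/
theorem norm_psiWeight_integrand {σ : ℝ} (hσ : 0 < σ) (q : ℝ) (w : ℂ) :
    ‖((σ ^ (-q) : ℝ) : ℂ) * Complex.exp (-(w / σ))‖ = σ ^ (-q) * Real.exp (-(w.re / σ)) := by
  rw [norm_mul, Complex.norm_real, Real.norm_of_nonneg (Real.rpow_nonneg hσ.le _),
    Complex.norm_exp]
  congr 2
  simp [Complex.neg_re, Complex.div_ofReal_re]

/-- **Majorant of the integrand of `Ψ_q` on a ball**: for `w ∈ ball w₀ R` and `σ > 1`,
`|σ^{-q} e^{-w/σ}| ≤ σ^{-q} e^{‖w₀‖ + R}`. [folklore] -/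
theorem norm_psiWeight_integrand_le {σ : ℝ} (hσ : 1 < σ) (q : ℝ) {w₀ w : ℂ} {R : ℝ}
    (hw : w ∈ ball w₀ R) :
    ‖((σ ^ (-q) : ℝ) : ℂ) * Complex.exp (-(w / σ))‖ ≤ σ ^ (-q) * Real.exp (‖w₀‖ + R) := by
  have hσ0 : 0 < σ := one_pos.trans hσ
  rw [norm_psiWeight_integrand hσ0]
  refine mul_le_mul_of_nonneg_left (Real.exp_le_exp.2 ?_) (Real.rpow_nonneg hσ0.le _)
  have h1 : -(w.re / σ) ≤ |w.re| / σ := by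
    rw [← neg_div]; exact div_le_div_of_nonneg_right (neg_le_abs _) hσ0.le
  have h2 : |w.re| / σ ≤ |w.re| := div_le_self (abs_nonneg _) hσ.le
  have h3 : |w.re| ≤ ‖w‖ := Complex.abs_re_le_norm w
  have h4 : ‖w‖ ≤ ‖w₀‖ + R := by
    rw [mem_ball, dist_eq_norm] at hw
    calc ‖w‖ = ‖(w - w₀) + w₀‖ := by rw [sub_add_cancel]
      _ ≤ ‖w - w₀‖ + ‖w₀‖ := norm_add_le _ _
      _ ≤ R + ‖w₀‖ := by linarith [hw.le]
      _ = ‖w₀‖ + R := add_comm _ _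
  linarith

/-- **`Ψ_q` is entire** for `q > 1` (holomorphic dependence of the dominated parameter integral:
the integrand is entire in `w` and bounded by `σ^{-q} e^{‖w₀‖+R} ∈ L¹(1, ∞)` on `ball w₀ R`).
[folklore] -/
theorem differentiable_psiWeight {q : ℝ} (hq : 1 < q) : Differentiable ℂ (psiWeight q) := by
  have h : DifferentiableOn ℂ (psiWeight q) univ := by
    unfold psiWeight
    refine Complex.differentiableOn_integral_of_dominated (fun w _ =>
      (measurable_psiWeight_integrand q w).aestronglyMeasurable) ?_ ?_
    · refine Eventually.of_forall fun σ => ?_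
      refine (Differentiable.differentiableOn ?_)
      exact (differentiable_const _).mul
        (Complex.differentiable_exp.comp ((differentiable_id.div_const _).neg))
    · intro w₀ _
      refine ⟨1, one_pos, subset_univ _, fun σ => σ ^ (-q) * Real.exp (‖w₀‖ + 1), ?_, ?_⟩
      · exact ((integrableOn_Ioi_rpow_of_lt (by linarith) one_pos).mul_const _)
      · rw [ae_restrict_iff' measurableSet_Ioi]
        exact Eventually.of_forall fun σ hσ w hw => norm_psiWeight_integrand_le hσ q hw
  exact fun w => (h w (mem_univ w)).differentiableAt (univ_mem)

/-- **`Ψ_q` in composable form**: `p ↦ Ψ_q(f p)` is complex differentiable where `f` is. [folklore] -/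
theorem _root_.DifferentiableAt.psiWeight {P : Type*} [NormedAddCommGroup P] [NormedSpace ℂ P]
    {q : ℝ} (hq : 1 < q) {f : P → ℂ} {p : P} (hf : DifferentiableAt ℂ f p) :
    DifferentiableAt ℂ (fun r => psiWeight q (f r)) p :=
  ((differentiable_psiWeight hq) (f p)).comp p hf

/-- **`Ψ_q` is real on the real axis**: `Ψ_q(r) = ∫_{σ>1} σ^{-q} e^{-r/σ} dσ` as a real integral.
[folklore] -/
theorem psiWeight_ofReal (q r : ℝ) :
    psiWeight q (r : ℂ) = ((∫ σ in Ioi (1 : ℝ), σ ^ (-q) * Real.exp (-(r / σ)) : ℝ) : ℂ) := by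
  unfold psiWeight
  rw [← integral_complex_ofReal]
  refine setIntegral_congr_fun measurableSet_Ioi fun σ _ => ?_
  simp only [Complex.ofReal_mul, Complex.ofReal_exp, Complex.ofReal_neg, Complex.ofReal_div]

/-! ### The complexified kernels -/

section Kernels

variable (ι)

/-- The real normalisation constant `(4π)^{-d/2}`, `d = |ι|`. [folklore] -/
def heatConst : ℝ := (4 * π) ^ (-(Fintype.card ι : ℝ) / 2)

variable {ι}

/-- `(4π)^{-d/2} > 0`. [folklore] -/
theorem heatConst_pos : 0 < heatConst ι := by
  unfold heatConst; positivity

/-- **The complexified Gauss–Weierstrass kernel in root time**: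
`heatKernelC m ζ = (4π)^{-d/2} m^{-d} exp(-ζ·ζ/(4m²))`, so that for `m = √t` and real `ζ = z`
this is `G_t(z) = (4πt)^{-d/2} e^{-|z|²/4t}` (`heatKernelC_sqrt_complexify`); holomorphic in
`(m, ζ)` on `{m ≠ 0}` (Lemarié-Rieusset 2016, proof of Thm. 9.12, p. 261: "the functions
`W_{νt}(x)` … have holomorphic extensions `W_{ντ}(z)`"). Junk (finite) values at `m = 0`.
[cite: LemarieRieusset2016, Thm. 9.12 (proof, p. 261)] -/
def heatKernelC (m : ℂ) (ζ : ℂE) : ℂ :=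
  (heatConst ι : ℂ) * (m ^ Fintype.card ι)⁻¹ * Complex.exp (-(cdot ζ ζ * (4 * m ^ 2)⁻¹))

/-- **The complexified first Oseen weight**:
`oseenWeightAC m ζ = (4π)^{-d/2} m^{-d} (4m²)^{-1} Ψ_{d/2+2}(ζ·ζ/4m²)`, the continuation of
`A(t, z) = ∫_t^∞ G_s(z)/(4s²) ds` (`oseenWeightA`; equality at `m = √t`, `ζ = z` real:
`oseenWeightAC_sqrt_complexify`). [cite: KochTataruAdvMath2001, §2 (6)–(8)] -/
def oseenWeightAC (m : ℂ) (ζ : ℂE) : ℂ :=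
  (heatConst ι : ℂ) * (m ^ Fintype.card ι)⁻¹ * (4 * m ^ 2)⁻¹ *
    psiWeight (Fintype.card ι / 2 + 2) (cdot ζ ζ * (4 * m ^ 2)⁻¹)

/-- **The complexified second Oseen weight**:
`oseenWeightBC m ζ = (4π)^{-d/2} m^{-d} (8m⁴)^{-1} Ψ_{d/2+3}(ζ·ζ/4m²)`, the continuation of
`B(t, z) = ∫_t^∞ G_s(z)/(8s³) ds` (`oseenWeightB`; `oseenWeightBC_sqrt_complexify`). [cite: KochTataruAdvMath2001, §2 (6)–(8)] -/
def oseenWeightBC (m : ℂ) (ζ : ℂE) : ℂ :=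
  (heatConst ι : ℂ) * (m ^ Fintype.card ι)⁻¹ * (8 * m ^ 4)⁻¹ *
    psiWeight (Fintype.card ι / 2 + 3) (cdot ζ ζ * (4 * m ^ 2)⁻¹)

/-- **The complexified Oseen–Koch–Tataru kernel in root time**: the closed Gaussian form of
`oseenKernel` (`KochTataru.lean`: `K(t,z)[a,b] = -(⟪z,a⟫/2t) G_t(z) b + A(t,z)(⟪z,a⟫b + ⟪a,b⟫z +
⟪z,b⟫a) - B(t,z)⟪z,a⟫⟪z,b⟫ z`) with every ingredient continued — `t = m²`, the inner products by
`cdot`, the Gaussian and the weights by `heatKernelC`, `oseenWeightAC`, `oseenWeightBC`, and the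
tensor slots `a, b ∈ ℂ^ι`. At `m = √t` and real arguments it is `cx (K(t,z)[a,b])`
(`oseenKernelC_sqrt_complexify`); it is holomorphic in `(m, ζ, a, b)` on `{m ≠ 0}`
(`DifferentiableAt.oseenKernelC`) — Lemarié-Rieusset 2016, proof of Thm. 9.12, p. 261: "the
functions `W_{νt}(x)` and `O_{j,k}(νt,x)` have holomorphic extensions". [cite: LemarieRieusset2016, Thm. 9.12 (proof, pp. 261–262)] -/
def oseenKernelC (m : ℂ) (ζ a b : ℂE) : ℂE :=
  (-(cdot ζ a * (2 * m ^ 2)⁻¹ * heatKernelC m ζ)) • b +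
    oseenWeightAC m ζ • (cdot ζ a • b + cdot a b • ζ + cdot ζ b • a) -
    (oseenWeightBC m ζ * (cdot ζ a * cdot ζ b)) • ζ

/-! ### Holomorphy -/

variable {P : Type*} [NormedAddCommGroup P] [NormedSpace ℂ P]

/-- `p ↦ (c (fm p)ᵏ)⁻¹` is complex differentiable where `fm p ≠ 0` (`c ≠ 0`). [folklore] -/
theorem differentiableAt_inv_const_mul_pow {fm : P → ℂ} {p : P} (hm : DifferentiableAt ℂ fm p)
    (h0 : fm p ≠ 0) {c : ℂ} (hc : c ≠ 0) (k : ℕ) :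
    DifferentiableAt ℂ (fun r => (c * fm r ^ k)⁻¹) p :=
  ((hm.pow k).const_mul c).inv (mul_ne_zero hc (pow_ne_zero _ h0))

/-- `p ↦ cdot (fζ p) (fζ p) (4 (fm p)²)⁻¹` is complex differentiable where `fm p ≠ 0`. [folklore] -/
theorem differentiableAt_cdot_div {fm : P → ℂ} {fζ : P → ℂE} {p : P}
    (hm : DifferentiableAt ℂ fm p) (hζ : DifferentiableAt ℂ fζ p) (h0 : fm p ≠ 0) :
    DifferentiableAt ℂ (fun r => cdot (fζ r) (fζ r) * (4 * fm r ^ 2)⁻¹) p :=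
  (hζ.cdot hζ).mul (differentiableAt_inv_const_mul_pow hm h0 (by norm_num) 2)

/-- **Holomorphy of the complexified Gaussian**: `p ↦ heatKernelC (fm p) (fζ p)` is complex
differentiable at `p` if `fm`, `fζ` are and `fm p ≠ 0`. [folklore] -/
theorem _root_.DifferentiableAt.heatKernelC {fm : P → ℂ} {fζ : P → ℂE} {p : P}
    (hm : DifferentiableAt ℂ fm p) (hζ : DifferentiableAt ℂ fζ p) (h0 : fm p ≠ 0) :
    DifferentiableAt ℂ (fun r => heatKernelC (fm r) (fζ r)) p := by
  unfold Literature.Analysis.FluidPDE.heatKernelC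
  refine ((differentiableAt_const _).mul ((hm.pow _).inv (pow_ne_zero _ h0))).mul ?_
  exact (differentiableAt_cdot_div hm hζ h0).neg.cexp

/-- **Holomorphy of the first complexified weight** (with `Ψ_{d/2+2}` entire). [folklore] -/
theorem _root_.DifferentiableAt.oseenWeightAC {fm : P → ℂ} {fζ : P → ℂE} {p : P}
    (hm : DifferentiableAt ℂ fm p) (hζ : DifferentiableAt ℂ fζ p) (h0 : fm p ≠ 0) :
    DifferentiableAt ℂ (fun r => oseenWeightAC (fm r) (fζ r)) p := by
  unfold Literature.Analysis.FluidPDE.oseenWeightAC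
  have hq : (1 : ℝ) < Fintype.card ι / 2 + 2 := by
    have : (0 : ℝ) ≤ Fintype.card ι := Nat.cast_nonneg _
    linarith
  refine (((differentiableAt_const _).mul ((hm.pow _).inv (pow_ne_zero _ h0))).mul
    (differentiableAt_inv_const_mul_pow hm h0 (by norm_num) 2)).mul ?_
  exact (differentiableAt_cdot_div hm hζ h0).psiWeight hq

/-- **Holomorphy of the second complexified weight** (with `Ψ_{d/2+3}` entire). [folklore] -/
theorem _root_.DifferentiableAt.oseenWeightBC {fm : P → ℂ} {fζ : P → ℂE} {p : P}
    (hm : DifferentiableAt ℂ fm p) (hζ : DifferentiableAt ℂ fζ p) (h0 : fm p ≠ 0) :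
    DifferentiableAt ℂ (fun r => oseenWeightBC (fm r) (fζ r)) p := by
  unfold Literature.Analysis.FluidPDE.oseenWeightBC
  have hq : (1 : ℝ) < Fintype.card ι / 2 + 3 := by
    have : (0 : ℝ) ≤ Fintype.card ι := Nat.cast_nonneg _
    linarith
  refine (((differentiableAt_const _).mul ((hm.pow _).inv (pow_ne_zero _ h0))).mul
    (differentiableAt_inv_const_mul_pow hm h0 (by norm_num) 4)).mul ?_
  exact (differentiableAt_cdot_div hm hζ h0).psiWeight hq

/-- **Holomorphy of the complexified Oseen kernel in all its arguments**: if `fm, fζ, fa, fb` are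
complex differentiable at `p` and `fm p ≠ 0`, then so is
`p ↦ oseenKernelC (fm p) (fζ p) (fa p) (fb p)` (Lemarié-Rieusset 2016, proof of Thm. 9.12,
p. 261). [cite: LemarieRieusset2016, Thm. 9.12 (proof, p. 261)] -/
theorem _root_.DifferentiableAt.oseenKernelC {fm : P → ℂ} {fζ fa fb : P → ℂE} {p : P}
    (hm : DifferentiableAt ℂ fm p) (hζ : DifferentiableAt ℂ fζ p) (ha : DifferentiableAt ℂ fa p)
    (hb : DifferentiableAt ℂ fb p) (h0 : fm p ≠ 0) :
    DifferentiableAt ℂ (fun r => oseenKernelC (fm r) (fζ r) (fa r) (fb r)) p := by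
  unfold Literature.Analysis.FluidPDE.oseenKernelC
  have h2 : DifferentiableAt ℂ (fun r => (2 * fm r ^ 2)⁻¹) p :=
    differentiableAt_inv_const_mul_pow hm h0 (by norm_num) 2
  refine ((((((hζ.cdot ha).mul h2).mul (hm.heatKernelC hζ h0)).neg).smul hb).add
    ((hm.oseenWeightAC hζ h0).smul ?_)).sub (((hm.oseenWeightBC hζ h0).mul
      ((hζ.cdot ha).mul (hζ.cdot hb))).smul hζ)
  exact (((hζ.cdot ha).smul hb).add ((ha.cdot hb).smul hζ)).add ((hζ.cdot hb).smul ha)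

end Kernels

/-! ### Real restriction -/

section RealRestriction

open UnboundedOperators (heatKernel)

/-- `(√t)^d = t^{d/2}` as a real power, `t ≥ 0`. [folklore] -/
theorem sqrt_pow_card (t : ℝ) (ht : 0 ≤ t) (d : ℕ) : Real.sqrt t ^ d = t ^ ((d : ℝ) / 2) := by
  rw [Real.sqrt_eq_rpow, ← Real.rpow_natCast, ← Real.rpow_mul ht]
  congr 1; ring

/-- The complex factor `(4π)^{-d/2} ((√t)^d)⁻¹` is the real normalisation `(4πt)^{-d/2}` of the
Gauss–Weierstrass kernel (`t > 0`, `d = |ι| = dim ℝ^ι`). [folklore] -/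
theorem heatConst_mul_inv_sqrt_pow {t : ℝ} (ht : 0 < t) :
    (heatConst ι : ℂ) * (((Real.sqrt t : ℝ) : ℂ) ^ Fintype.card ι)⁻¹ =
      (((4 * π * t) ^ (-(Module.finrank ℝ ℝE : ℝ) / 2) : ℝ) : ℂ) := by
  rw [finrank_euclideanSpace, ← Complex.ofReal_pow, ← Complex.ofReal_inv, ← Complex.ofReal_mul]
  congr 1
  rw [heatConst, sqrt_pow_card t ht.le, ← Real.rpow_neg ht.le,
    Real.mul_rpow (by positivity) ht.le]
  congr 1; ring

/-- `cdot (cx z) (cx z) (4 (√t)²)⁻¹ = |z|²/(4t)` (real). [folklore] -/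
theorem cdot_complexify_div_sqrt {t : ℝ} (ht : 0 < t) (z : ℝE) :
    cdot (complexify z) (complexify z) * (4 * (((Real.sqrt t : ℝ) : ℂ)) ^ 2)⁻¹ =
      (((‖z‖ ^ 2 / (4 * t)) : ℝ) : ℂ) := by
  rw [cdot_complexify_self, ← Complex.ofReal_pow, Real.sq_sqrt ht.le]
  push_cast
  ring

/-- **Real restriction of the Gaussian**: `heatKernelC √t (cx z) = G_t(z)` for `t > 0`.
[folklore] -/
theorem heatKernelC_sqrt_complexify {t : ℝ} (ht : 0 < t) (z : ℝE) :
    heatKernelC (Real.sqrt t : ℂ) (complexify z) = ((heatKernel t z : ℝ) : ℂ) := by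
  unfold heatKernelC UnboundedOperators.heatKernel
  rw [heatConst_mul_inv_sqrt_pow ht, cdot_complexify_div_sqrt ht z]
  simp only [Complex.ofReal_mul, Complex.ofReal_exp, Complex.ofReal_neg, Complex.ofReal_div,
    neg_div]

/-- **The substitution `s = tσ` in the weights**: for `t > 0`, `c ≠ 0`, `k : ℕ`,
`∫_{s>t} G_s(z)/(c sᵏ) ds = (4πt)^{-d/2} (t/(c tᵏ)) ∫_{σ>1} σ^{-(d/2+k)} e^{-(|z|²/4t)/σ} dσ`
(`MeasureTheory.integral_comp_mul_left_Ioi`). [folklore] -/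
theorem integral_Ioi_heatKernel_div_pow {t : ℝ} (ht : 0 < t) (z : ℝE) {c : ℝ} (hc : c ≠ 0)
    (k : ℕ) :
    ∫ s in Ioi t, heatKernel s z / (c * s ^ k) =
      (4 * π * t) ^ (-(Module.finrank ℝ ℝE : ℝ) / 2) * (t / (c * t ^ k)) *
        ∫ σ in Ioi (1 : ℝ), σ ^ (-((Fintype.card ι : ℝ) / 2 + k)) *
          Real.exp (-(‖z‖ ^ 2 / (4 * t) / σ)) := by
  have hsub := integral_comp_mul_left_Ioi (fun s => heatKernel s z / (c * s ^ k)) 1 ht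
  rw [mul_one] at hsub
  have h1 : ∫ s in Ioi t, heatKernel s z / (c * s ^ k) =
      t * ∫ σ in Ioi (1 : ℝ), heatKernel (t * σ) z / (c * (t * σ) ^ k) := by
    rw [hsub, smul_eq_mul, ← mul_assoc, mul_inv_cancel₀ ht.ne', one_mul]
  rw [h1, ← integral_const_mul, ← integral_const_mul]
  refine setIntegral_congr_fun measurableSet_Ioi fun σ hσ => ?_
  have hσ0 : 0 < σ := one_pos.trans hσ
  have hσne : σ ≠ 0 := hσ0.ne'
  have htne : t ≠ 0 := ht.ne'
  simp only [finrank_euclideanSpace]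
  unfold UnboundedOperators.heatKernel
  rw [finrank_euclideanSpace]
  have e1 : (4 * π * (t * σ)) ^ (-(Fintype.card ι : ℝ) / 2) =
      (4 * π * t) ^ (-(Fintype.card ι : ℝ) / 2) * σ ^ (-(Fintype.card ι : ℝ) / 2) := by
    rw [show 4 * π * (t * σ) = (4 * π * t) * σ by ring]
    exact Real.mul_rpow (by positivity) hσ0.le
  have e2 : σ ^ (-((Fintype.card ι : ℝ) / 2 + k)) = σ ^ (-(Fintype.card ι : ℝ) / 2) * (σ ^ k)⁻¹ := by
    rw [show -((Fintype.card ι : ℝ) / 2 + k) = -(Fintype.card ι : ℝ) / 2 + -(k : ℝ) by ring,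
      Real.rpow_add hσ0, Real.rpow_neg hσ0.le, Real.rpow_natCast]
  have e3 : -‖z‖ ^ 2 / (4 * (t * σ)) = -(‖z‖ ^ 2 / (4 * t) / σ) := by
    field_simp
  rw [e1, e2, e3, mul_pow]
  field_simp

/-- **Real restriction of the first weight**: `oseenWeightAC √t (cx z) = A(t, z)` for `t > 0`.
[folklore] -/
theorem oseenWeightAC_sqrt_complexify {t : ℝ} (ht : 0 < t) (z : ℝE) :
    oseenWeightAC (Real.sqrt t : ℂ) (complexify z) = ((oseenWeightA t z : ℝ) : ℂ) := by
  unfold oseenWeightAC oseenWeightA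
  rw [heatConst_mul_inv_sqrt_pow ht, cdot_complexify_div_sqrt ht z, psiWeight_ofReal,
    integral_Ioi_heatKernel_div_pow ht z (by norm_num : (4 : ℝ) ≠ 0) 2, ← Complex.ofReal_pow,
    Real.sq_sqrt ht.le]
  have htne : (t : ℂ) ≠ 0 := Complex.ofReal_ne_zero.2 ht.ne'
  push_cast
  field_simp

/-- **Real restriction of the second weight**: `oseenWeightBC √t (cx z) = B(t, z)` for `t > 0`.
[folklore] -/
theorem oseenWeightBC_sqrt_complexify {t : ℝ} (ht : 0 < t) (z : ℝE) :
    oseenWeightBC (Real.sqrt t : ℂ) (complexify z) = ((oseenWeightB t z : ℝ) : ℂ) := by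
  unfold oseenWeightBC oseenWeightB
  rw [heatConst_mul_inv_sqrt_pow ht, cdot_complexify_div_sqrt ht z, psiWeight_ofReal,
    integral_Ioi_heatKernel_div_pow ht z (by norm_num : (8 : ℝ) ≠ 0) 3, ← Complex.ofReal_pow]
  have e4 : ((Real.sqrt t : ℝ) ^ 4 : ℝ) = t ^ 2 := by
    rw [show (4 : ℕ) = 2 * 2 by norm_num, pow_mul, Real.sq_sqrt ht.le]
  rw [e4]
  have htne : (t : ℂ) ≠ 0 := Complex.ofReal_ne_zero.2 ht.ne'
  push_cast
  field_simp

/-- Complexification commutes with real scalar multiplication: `cx (r • v) = (r : ℂ) • cx v`.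
[folklore] -/
theorem complexify_smul (r : ℝ) (v : ℝE) : complexify (r • v) = (r : ℂ) • complexify v := by
  ext i
  simp [complexify_apply]

/-- **Real restriction of the complexified Oseen kernel**:
`oseenKernelC √t (cx z) (cx a) (cx b) = cx (K(t, z)[a, b])` for `t > 0` — every continued
ingredient restricts to its real counterpart, and `cx` is real-linear. [cite: KochTataruAdvMath2001, §2 (6)–(8)] -/
theorem oseenKernelC_sqrt_complexify {t : ℝ} (ht : 0 < t) (z a b : ℝE) :
    oseenKernelC (Real.sqrt t : ℂ) (complexify z) (complexify a) (complexify b) =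
      complexify (oseenKernel t z a b) := by
  have hG := heatKernelC_sqrt_complexify ht z
  have hA := oseenWeightAC_sqrt_complexify ht z
  have hB := oseenWeightBC_sqrt_complexify ht z
  have hsq : ((Real.sqrt t : ℝ) : ℂ) ^ 2 = (t : ℂ) := by
    rw [← Complex.ofReal_pow, Real.sq_sqrt ht.le]
  ext i
  simp only [oseenKernelC, oseenKernel, hG, hA, hB, cdot_complexify, hsq, PiLp.add_apply,
    PiLp.sub_apply, PiLp.smul_apply, complexify_apply, smul_eq_mul]
  push_cast
  ring

end RealRestriction

end Literature.Analysis.FluidPDE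

end
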